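import Mathlib
import Summits.MatrixMultiplication.MatrixMultiplication.Theorems.SnSubsetDichotomyPolynomialSlackMarginals
import Summits.MatrixMultiplication.MatrixMultiplication.Theorems.SnSubsetDichotomyPolynomialSlackCylinderMarginals
import Summits.MatrixMultiplication.MatrixMultiplication.Theorems.SnSubsetDichotomyPolynomialSlackLevelOnePinning

/-!
# The exact point-cylinder formula: six-fold fixed points when one member fixes a point

Crux `Summit.MatrixMultiplication.MatrixMultiplication.Theses.SnSubsetDichotomy.PolynomialSlack`
(item `stmt-MatrixMultiplication-8306`), level-one programme, lead c3 (crux notes §C, formula (★)/(CYL)).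
For `S, T, U ⊆ S_n` with marginal counts `c_X(v,q) = #{x ∈ X : x q = v}` and pair marginals
`m_{XY}(i,j) = #{(x,y) : y j = x i}`, the six-fold fixed-point count of the level-one pinning is
`T₃ = Σ_{p,q,w} m_{ST}(p,w) m_{TU}(w,q) m_{US}(q,p)` (tree: `sixFoldFix_eq_tripleSum`). If `U` lies in the
point cylinder `{u : u j₀ = i₀}` then, EXACTLY,

  `T₃ = N²·(n-2)/(n-1) + (n/(n-1))·|U|²·P + |U|²·Q`,   `P = Σ_{p,w} m_{ST}(p,w)·c_S(i₀,p)·c_T(i₀,w)`,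

where `Q = Σ_{q ≠ j₀} Σ_{p,w} m_{ST}(p,w)·e_T(q,w)·e_S(q,p)` collects the INNER level-one structure of `U`
(`e_X(q,·) = Σ_v ε(v,q)·c_X(v,·)`, `ε(v,q) = c_U(v,q)/|U| - (1 - [v = i₀])/(n-1)` the deviation of `U`'s
profile from the full cylinder's; the linear terms vanish because `Σ_{q ≠ j₀} ε(v,q) = 0`), and by two
Cauchy–Schwarz steps `|Q| ≤ |S|²|T|²·η'`, `η' = Σ_v Σ_{q ≠ j₀} ε(v,q)²`. Hence (`cylinder_sixFold_lower`)

  `T₃ ≥ N²·(n-2)/(n-1) + (n/(n-1))·|U|²·P - N²·η'`,   and `P ≥ (Σ_p c_S(i₀,p)²)·(Σ_w c_T(i₀,w)²)`.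

Played against the level-one pinning (`levelOnePinning`), this pins the pull-backs of `i₀` under `S` and
`T` (`P/(|S|²|T|²) = P[(tt'⁻¹)(i₀) = (ss'⁻¹)(i₀)]`) to `≲ (n-1)η' + F/n` — see the follow-up file. Elementary
(Cauchy–Schwarz only); checked exactly on random instances by compute/cyl_check.py of the lead's folder.
-/

namespace Summit.MatrixMultiplication.MatrixMultiplication.Theorems.PolynomialSlack

open scoped BigOperators
open Literature.Combinatorics.Additive (TripleProductProperty)

set_option linter.dupNamespace false

variable {n : ℕ}

/-! ## The cylinder formula -/

set_option maxHeartbeats 1600000 in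
/-- **The point-cylinder formula, lower half (CYL).** For `n ≥ 2`, non-empty `S, T ⊆ S_n` and a
non-empty `U` inside the point cylinder `{u : u j₀ = i₀}`, with `N = |S||T||U|`, marginal counts
`c_X(v,q) = #{x ∈ X : x q = v}`, pair marginal `m_{ST}(p,w) = #{(s,t) : t w = s p}`,
`P = Σ_{p,w} m_{ST}(p,w)·c_S(i₀,p)·c_T(i₀,w)` and the inner level-one energy of `U`,
`η' = Σ_v Σ_{q ≠ j₀} (c_U(v,q)/|U| - [v ≠ i₀]/(n-1))²`, the six-fold fixed-point count satisfies
`T₃ ≥ N²·(n-2)/(n-1) + (n/(n-1))·|U|²·P - N²·η'`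
(in fact `T₃ = N²(n-2)/(n-1) + (n/(n-1))|U|²P + |U|²Q` with `|Q| ≤ |S|²|T|²η'`). [folklore] -/
theorem cylinder_sixFold_lower (hn : 2 ≤ n) (S T U : Finset (Equiv.Perm (Fin n))) (i₀ j₀ : Fin n)
    (hS : S.Nonempty) (hT : T.Nonempty) (hUne : U.Nonempty) (hU : ∀ u ∈ U, u j₀ = i₀) :
    ((S.card : ℝ) * T.card * U.card) ^ 2 * (((n : ℝ) - 2) / ((n : ℝ) - 1)) +
        (n : ℝ) / ((n : ℝ) - 1) * (U.card : ℝ) ^ 2 *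
          (∑ p : Fin n, ∑ w : Fin n, (((S ×ˢ T).filter fun st => st.2 w = st.1 p).card : ℝ) *
            ((S.filter fun s => s p = i₀).card : ℝ) * ((T.filter fun t => t w = i₀).card : ℝ)) -
        ((S.card : ℝ) * T.card * U.card) ^ 2 *
          (∑ v : Fin n, ∑ q ∈ Finset.univ.erase j₀,
            (((U.filter fun u => u q = v).card : ℝ) / U.card -
              (if v = i₀ then (0 : ℝ) else 1 / ((n : ℝ) - 1))) ^ 2) ≤
      ((∑ y ∈ ((S ×ˢ T) ×ˢ (T ×ˢ U)) ×ˢ (U ×ˢ S),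
          (Finset.univ.filter fun p : Fin n =>
            (y.1.1.1⁻¹ * y.1.1.2 * (y.1.2.1⁻¹ * y.1.2.2) * (y.2.1⁻¹ * y.2.2)) p = p).card : ℕ) : ℝ) := by
  classical
  rw [sixFoldFix_eq_tripleSum]
  push_cast
  -- notation
  set sR : ℝ := (S.card : ℝ) with hsR
  set tR : ℝ := (T.card : ℝ) with htR
  set uR : ℝ := (U.card : ℝ) with huR
  have hsR0 : 0 < sR := by rw [hsR]; exact_mod_cast hS.card_pos
  have htR0 : 0 < tR := by rw [htR]; exact_mod_cast hT.card_pos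
  have huR0 : 0 < uR := by rw [huR]; exact_mod_cast hUne.card_pos
  have hn1 : (1 : ℝ) < n := by exact_mod_cast hn
  have hm0 : (0 : ℝ) < (n : ℝ) - 1 := by linarith
  set a : Fin n → Fin n → ℝ := fun p w => (((S ×ˢ T).filter fun st => st.2 w = st.1 p).card : ℝ) with ha
  set cS : Fin n → Fin n → ℝ := fun v p => ((S.filter fun s => s p = v).card : ℝ) with hcS
  set cT : Fin n → Fin n → ℝ := fun v w => ((T.filter fun t => t w = v).card : ℝ) with hcT
  set cU : Fin n → Fin n → ℝ := fun v q => ((U.filter fun u => u q = v).card : ℝ) with hcU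
  -- the two pair marginals through `U` factor over the common value
  have hb : ∀ w q, (((T ×ˢ U).filter fun tu => tu.2 q = tu.1 w).card : ℝ) = ∑ v, cT v w * cU v q :=
    fun w q => pairMarginal_eq_sum_mul T U w q
  have hc : ∀ q p, (((U ×ˢ S).filter fun us => us.2 p = us.1 q).card : ℝ) = ∑ v, cU v q * cS v p :=
    fun q p => pairMarginal_eq_sum_mul U S q p
  -- sums of marginals
  have ha0 : ∀ p w, 0 ≤ a p w := fun p w => Nat.cast_nonneg _
  have harow : ∀ w, ∑ p, a p w = sR * tR := fun w => by
    have h := sum_pairMarginal_fst S T w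
    have h' := congrArg (fun m : ℕ => (m : ℝ)) h
    push_cast at h'
    exact h'
  have hacol : ∀ p, ∑ w, a p w = sR * tR := fun p => by
    have h := sum_pairMarginal_snd S T p
    have h' := congrArg (fun m : ℕ => (m : ℝ)) h
    push_cast at h'
    exact h'
  have hcScol : ∀ p, ∑ v, cS v p = sR := fun p => sum_marginal_col S p
  have hcTcol : ∀ w, ∑ v, cT v w = tR := fun w => sum_marginal_col T w
  have hcSrow : ∀ v, ∑ p, cS v p = sR := fun v => sum_marginal_row S v
  have hcTrow : ∀ v, ∑ w, cT v w = tR := fun v => sum_marginal_row T v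
  have hcUrow : ∀ v, ∑ q, cU v q = uR := fun v => sum_marginal_row U v
  have hcS0 : ∀ v p, 0 ≤ cS v p := fun v p => Nat.cast_nonneg _
  have hcT0 : ∀ v w, 0 ≤ cT v w := fun v w => Nat.cast_nonneg _
  -- the cylinder
  have hcUj : ∀ v, cU v j₀ = if v = i₀ then uR else 0 := by
    intro v
    simp only [hcU, huR]
    split_ifs with hv
    · congr 2
      exact Finset.filter_true_of_mem fun u hu => by rw [hU u hu, hv]
    · rw [Nat.cast_eq_zero, Finset.card_eq_zero, Finset.filter_eq_empty_iff]
      intro u hu h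
      exact hv (by rw [← h, hU u hu])
  have hcUi : ∀ q, q ≠ j₀ → cU i₀ q = 0 := by
    intro q hq
    simp only [hcU]
    rw [Nat.cast_eq_zero, Finset.card_eq_zero, Finset.filter_eq_empty_iff]
    intro u hu h
    have : q = j₀ := u.injective (by rw [h, hU u hu])
    exact hq this
  -- the flat reference and the deviation
  set f : Fin n → ℝ := fun v => if v = i₀ then (0 : ℝ) else 1 / ((n : ℝ) - 1) with hf
  set ε : Fin n → Fin n → ℝ := fun v q => cU v q / uR - f v with hε
  have hcUε : ∀ v q, cU v q = uR * (f v + ε v q) := fun v q => by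
    simp only [hε]; field_simp; ring
  have hεsum : ∀ v, ∑ q ∈ Finset.univ.erase j₀, ε v q = 0 := by
    intro v
    have h0 : cU v j₀ + ∑ q ∈ Finset.univ.erase j₀, cU v q = uR := by
      rw [Finset.add_sum_erase _ _ (Finset.mem_univ j₀)]; exact hcUrow v
    have hcard : ((Finset.univ.erase j₀).card : ℝ) = (n : ℝ) - 1 := by
      rw [Finset.card_erase_of_mem (Finset.mem_univ j₀), Finset.card_univ, Fintype.card_fin,
        Nat.cast_sub (by omega : 1 ≤ n), Nat.cast_one]
    have e : ∑ q ∈ Finset.univ.erase j₀, ε v q =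
        (∑ q ∈ Finset.univ.erase j₀, cU v q) / uR - ((Finset.univ.erase j₀).card : ℝ) * f v := by
      simp only [hε]
      rw [Finset.sum_sub_distrib, Finset.sum_div, Finset.sum_const, nsmul_eq_mul]
    rw [e, hcard]
    by_cases hv : v = i₀
    · have h1 : cU v j₀ = uR := by rw [hcUj v, if_pos hv]
      have h2 : f v = 0 := by simp only [hf]; rw [if_pos hv]
      have h3 : ∑ q ∈ Finset.univ.erase j₀, cU v q = 0 := by linarith
      rw [h3, h2]; simp
    · have h1 : cU v j₀ = 0 := by rw [hcUj v, if_neg hv]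
      have h2 : f v = 1 / ((n : ℝ) - 1) := by simp only [hf]; rw [if_neg hv]
      have h3 : ∑ q ∈ Finset.univ.erase j₀, cU v q = uR := by linarith
      rw [h3, h2]; field_simp; ring
  -- flat parts
  set dS : Fin n → ℝ := fun p => cS i₀ p with hdS
  set dT : Fin n → ℝ := fun w => cT i₀ w with hdT
  have hFT : ∀ w, ∑ v, f v * cT v w = (tR - dT w) / ((n : ℝ) - 1) := fun w => by
    simp only [hf]
    rw [sum_ite_ne_mul i₀ (1 / ((n : ℝ) - 1)) (fun v => cT v w), hcTcol w]
    simp only [hdT]; field_simp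
  have hFS : ∀ p, ∑ v, f v * cS v p = (sR - dS p) / ((n : ℝ) - 1) := fun p => by
    simp only [hf]
    rw [sum_ite_ne_mul i₀ (1 / ((n : ℝ) - 1)) (fun v => cS v p), hcScol p]
    simp only [hdS]; field_simp
  -- deviation parts
  set eT : Fin n → Fin n → ℝ := fun q w => ∑ v, ε v q * cT v w with heT
  set eS : Fin n → Fin n → ℝ := fun q p => ∑ v, ε v q * cS v p with heS
  have hbq : ∀ w q, ∑ v, cT v w * cU v q = uR * ((tR - dT w) / ((n : ℝ) - 1) + eT q w) := by
    intro w q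
    rw [← hFT w]
    simp only [heT]
    rw [← Finset.sum_add_distrib, Finset.mul_sum]
    refine Finset.sum_congr rfl fun v _ => ?_
    rw [hcUε v q]; ring
  have hcq : ∀ q p, ∑ v, cU v q * cS v p = uR * ((sR - dS p) / ((n : ℝ) - 1) + eS q p) := by
    intro q p
    rw [← hFS p]
    simp only [heS]
    rw [← Finset.sum_add_distrib, Finset.mul_sum]
    refine Finset.sum_congr rfl fun v _ => ?_
    rw [hcUε v q]; ring
  have heTsum : ∀ w, ∑ q ∈ Finset.univ.erase j₀, eT q w = 0 := fun w => by
    simp only [heT]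
    rw [Finset.sum_comm]
    refine Finset.sum_eq_zero fun v _ => ?_
    rw [← Finset.sum_mul, hεsum v, zero_mul]
  have heSsum : ∀ p, ∑ q ∈ Finset.univ.erase j₀, eS q p = 0 := fun p => by
    simp only [heS]
    rw [Finset.sum_comm]
    refine Finset.sum_eq_zero fun v _ => ?_
    rw [← Finset.sum_mul, hεsum v, zero_mul]
  -- the `q = j₀` slice
  have hbj : ∀ w, ∑ v, cT v w * cU v j₀ = uR * dT w := fun w => by
    simp_rw [hcUj]
    simp [hdT, mul_comm]
  have hcj : ∀ p, ∑ v, cU v j₀ * cS v p = uR * dS p := fun p => by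
    simp_rw [hcUj]
    simp [hdS]
  -- P and the auxiliary sums
  set P : ℝ := ∑ p, ∑ w, a p w * dS p * dT w with hP
  have hsuma : ∑ p, ∑ w, a p w = n * (sR * tR) := by
    rw [Finset.sum_comm]
    simp_rw [harow]
    simp
  have hsumadS : ∑ p, ∑ w, a p w * dS p = sR * tR * sR := by
    have : ∀ p, ∑ w, a p w * dS p = sR * tR * dS p := fun p => by
      rw [← Finset.sum_mul, hacol p]
    simp_rw [this]
    rw [← Finset.mul_sum]
    simp only [hdS]; rw [hcSrow i₀]
  have hsumadT : ∑ p, ∑ w, a p w * dT w = sR * tR * tR := by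
    rw [Finset.sum_comm]
    have : ∀ w, ∑ p, a p w * dT w = sR * tR * dT w := fun w => by
      rw [← Finset.sum_mul, harow w]
    simp_rw [this]
    rw [← Finset.mul_sum]
    simp only [hdT]; rw [hcTrow i₀]
  -- the main sum, sliced over `q`
  set G : Fin n → ℝ := fun q => ∑ p, ∑ w, a p w * ((∑ v, cT v w * cU v q) * (∑ v, cU v q * cS v p))
    with hG
  have hmain : ∑ p, ∑ q, ∑ w, a p w *
      ((((T ×ˢ U).filter fun tu => tu.2 q = tu.1 w).card : ℝ) *
        (((U ×ˢ S).filter fun us => us.2 p = us.1 q).card : ℝ)) = ∑ q, G q := by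
    rw [Finset.sum_comm]
    refine Finset.sum_congr rfl fun q _ => ?_
    simp only [hG]
    refine Finset.sum_congr rfl fun p _ => Finset.sum_congr rfl fun w _ => ?_
    rw [hb w q, hc q p]
  -- value at `j₀`
  have hGj : G j₀ = uR ^ 2 * P := by
    simp only [hG, hP]
    simp_rw [hbj, hcj]
    rw [Finset.mul_sum]
    refine Finset.sum_congr rfl fun p _ => ?_
    rw [Finset.mul_sum]
    refine Finset.sum_congr rfl fun w _ => ?_
    ring
  -- value off `j₀`
  set Q : ℝ := ∑ q ∈ Finset.univ.erase j₀, ∑ p, ∑ w, a p w * eT q w * eS q p with hQ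
  have hGoff : ∑ q ∈ Finset.univ.erase j₀, G q =
      uR ^ 2 * ((((n : ℝ) - 2) * (sR * tR) ^ 2 + P) / ((n : ℝ) - 1) + Q) := by
    -- expand each slice
    have hslice : ∀ q, G q = uR ^ 2 * (∑ p, ∑ w, a p w * ((tR - dT w) / ((n : ℝ) - 1)) *
        ((sR - dS p) / ((n : ℝ) - 1))) +
        uR ^ 2 * (∑ p, ∑ w, a p w * ((tR - dT w) / ((n : ℝ) - 1)) * eS q p) +
        uR ^ 2 * (∑ p, ∑ w, a p w * eT q w * ((sR - dS p) / ((n : ℝ) - 1))) +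
        uR ^ 2 * (∑ p, ∑ w, a p w * eT q w * eS q p) := by
      intro q
      simp only [hG]
      simp_rw [hbq, hcq]
      rw [Finset.mul_sum, Finset.mul_sum, Finset.mul_sum, Finset.mul_sum, ← Finset.sum_add_distrib,
        ← Finset.sum_add_distrib, ← Finset.sum_add_distrib]
      refine Finset.sum_congr rfl fun p _ => ?_
      rw [Finset.mul_sum, Finset.mul_sum, Finset.mul_sum, Finset.mul_sum, ← Finset.sum_add_distrib,
        ← Finset.sum_add_distrib, ← Finset.sum_add_distrib]
      refine Finset.sum_congr rfl fun w _ => ?_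
      ring
    -- the two linear terms vanish after summing over `q`
    have hlin1 : ∑ q ∈ Finset.univ.erase j₀,
        ∑ p, ∑ w, a p w * ((tR - dT w) / ((n : ℝ) - 1)) * eS q p = 0 := by
      rw [Finset.sum_comm]
      refine Finset.sum_eq_zero fun p _ => ?_
      rw [Finset.sum_comm]
      refine Finset.sum_eq_zero fun w _ => ?_
      rw [← Finset.mul_sum, heSsum p, mul_zero]
    have hlin2 : ∑ q ∈ Finset.univ.erase j₀,
        ∑ p, ∑ w, a p w * eT q w * ((sR - dS p) / ((n : ℝ) - 1)) = 0 := by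
      rw [Finset.sum_comm]
      refine Finset.sum_eq_zero fun p _ => ?_
      rw [Finset.sum_comm]
      refine Finset.sum_eq_zero fun w _ => ?_
      have : ∀ q, a p w * eT q w * ((sR - dS p) / ((n : ℝ) - 1)) =
          (a p w * ((sR - dS p) / ((n : ℝ) - 1))) * eT q w := fun q => by ring
      simp_rw [this]
      rw [← Finset.mul_sum, heTsum w, mul_zero]
    -- the flat term
    have hflat : ∑ p, ∑ w, a p w * ((tR - dT w) / ((n : ℝ) - 1)) * ((sR - dS p) / ((n : ℝ) - 1)) =
        (((n : ℝ) - 2) * (sR * tR) ^ 2 + P) / ((n : ℝ) - 1) ^ 2 := by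
      have : ∀ p w, a p w * ((tR - dT w) / ((n : ℝ) - 1)) * ((sR - dS p) / ((n : ℝ) - 1)) =
          (1 / ((n : ℝ) - 1) ^ 2) * (tR * sR * a p w) - (1 / ((n : ℝ) - 1) ^ 2) * (tR * (a p w * dS p)) -
            (1 / ((n : ℝ) - 1) ^ 2) * (sR * (a p w * dT w)) +
            (1 / ((n : ℝ) - 1) ^ 2) * (a p w * dS p * dT w) := fun p w => by field_simp; ring
      simp_rw [this]
      simp only [Finset.sum_add_distrib, Finset.sum_sub_distrib, ← Finset.mul_sum]
      rw [hsuma, hsumadS, hsumadT, ← hP]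
      field_simp
      ring
    simp_rw [hslice]
    rw [Finset.sum_add_distrib, Finset.sum_add_distrib, Finset.sum_add_distrib, ← Finset.mul_sum,
      ← Finset.mul_sum, ← Finset.mul_sum, ← Finset.mul_sum, hlin1, hlin2, ← hQ, Finset.sum_const,
      Finset.card_erase_of_mem (Finset.mem_univ j₀), Finset.card_univ, Fintype.card_fin, nsmul_eq_mul,
      hflat]
    have hn1' : ((n - 1 : ℕ) : ℝ) = (n : ℝ) - 1 := by
      rw [Nat.cast_sub (by omega : 1 ≤ n), Nat.cast_one]
    rw [hn1']
    field_simp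
    ring
  -- the bound on `Q`
  have hQ_bound : |Q| ≤ (sR * tR) ^ 2 *
      ∑ v, ∑ q ∈ Finset.univ.erase j₀, (cU v q / uR - (if v = i₀ then (0 : ℝ) else 1 / ((n : ℝ) - 1))) ^ 2 := by
    have hEq : ∑ v, ∑ q ∈ Finset.univ.erase j₀,
        (cU v q / uR - (if v = i₀ then (0 : ℝ) else 1 / ((n : ℝ) - 1))) ^ 2 =
        ∑ q ∈ Finset.univ.erase j₀, ∑ v, ε v q ^ 2 := by
      rw [Finset.sum_comm]
    rw [hEq, Finset.mul_sum]
    refine (Finset.abs_sum_le_sum_abs _ _).trans (Finset.sum_le_sum fun q _ => ?_)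
    -- one slice: kernel Cauchy–Schwarz with `c = sR/tR`, then marginal Cauchy–Schwarz
    have hker := abs_sum_kernel_le a ha0 (sR * tR) harow hacol (eT q) (eS q) (sR / tR)
      (div_pos hsR0 htR0)
    have heT2 : ∑ w, eT q w ^ 2 ≤ (∑ v, ε v q ^ 2 * ∑ w, cT v w) * tR :=
      sum_sq_sum_mul_le (fun v => ε v q) cT hcT0 tR hcTcol
    have heS2 : ∑ p, eS q p ^ 2 ≤ (∑ v, ε v q ^ 2 * ∑ p, cS v p) * sR :=
      sum_sq_sum_mul_le (fun v => ε v q) cS hcS0 sR hcScol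
    simp_rw [hcTrow] at heT2
    simp_rw [hcSrow] at heS2
    rw [← Finset.sum_mul] at heT2 heS2
    set E : ℝ := ∑ v, ε v q ^ 2 with hE
    have hE0 : 0 ≤ E := Finset.sum_nonneg fun _ _ => sq_nonneg _
    calc |∑ p, ∑ w, a p w * eT q w * eS q p|
        ≤ sR * tR / 2 * (sR / tR * ∑ w, eT q w ^ 2 + (sR / tR)⁻¹ * ∑ p, eS q p ^ 2) := hker
      _ ≤ sR * tR / 2 * (sR / tR * (E * tR * tR) + (sR / tR)⁻¹ * (E * sR * sR)) := by
          have hc0 : 0 ≤ sR / tR := (div_pos hsR0 htR0).le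
          have hci : 0 ≤ (sR / tR)⁻¹ := inv_nonneg.2 hc0
          have hst : 0 ≤ sR * tR / 2 := by nlinarith
          exact mul_le_mul_of_nonneg_left (add_le_add (mul_le_mul_of_nonneg_left heT2 hc0)
            (mul_le_mul_of_nonneg_left heS2 hci)) hst
      _ = (sR * tR) ^ 2 * E := by field_simp; ring
  -- assemble
  rw [hmain, ← Finset.add_sum_erase Finset.univ G (Finset.mem_univ j₀), hGj, hGoff]
  have hQ' : -((sR * tR) ^ 2 *
      ∑ v, ∑ q ∈ Finset.univ.erase j₀, (cU v q / uR - (if v = i₀ then (0 : ℝ) else 1 / ((n : ℝ) - 1))) ^ 2) ≤ Q :=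
    (neg_le_neg hQ_bound).trans (neg_abs_le Q)
  have huR2 : 0 ≤ uR ^ 2 := sq_nonneg _
  have e1 : (sR * tR * uR) ^ 2 * (((n : ℝ) - 2) / ((n : ℝ) - 1)) + (n : ℝ) / ((n : ℝ) - 1) * uR ^ 2 * P =
      uR ^ 2 * P + uR ^ 2 * ((((n : ℝ) - 2) * (sR * tR) ^ 2 + P) / ((n : ℝ) - 1)) := by
    field_simp; ring
  nlinarith [mul_le_mul_of_nonneg_left hQ' huR2]

/-! ## Against the pinning: a cylinder member pins the pull-backs of its point -/

set_option maxHeartbeats 800000 in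
/-- **(PIN-CYL).** For `n ≥ 40` and a parity-pure TPP triple `S, T, U ⊆ S_n` (non-empty) whose member `U`
lies in the point cylinder `{u : u j₀ = i₀}`, with `N = |S||T||U|`, `D = n(n-1)/6`,
`P = Σ_{p,w} m_{ST}(p,w)·c_S(i₀,p)·c_T(i₀,w)` (so `P/(|S|²|T|²) = P[(tt'⁻¹)(i₀) = (ss'⁻¹)(i₀)] ≥ ‖d_S‖²‖d_T‖²`)
and `η'` the inner level-one energy of `U`:
`n·|U|²·P ≤ (n-1)·N²·η' + n!·N/2 + N·n!·√(n!)/(2√D)`.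
Dividing by `N²`: `n·P[(tt'⁻¹)(i₀) = (ss'⁻¹)(i₀)] ≤ (n-1)η' + n!/(2N) + n!^{3/2}/(2N√D)` — at volume
`N = n!^{3/2}/F` the right-hand side is `(n-1)η' + O(F/n)`: unless `U` carries inner structure, both `S` and
`T` pull `i₀` back almost uniformly from `≳ n/F` positions (`levelOnePinning` + `cylinder_sixFold_lower`).
[folklore] -/
theorem cylinder_pullback_pinned (n : ℕ) (hn : 40 ≤ n) (S T U : Finset (Equiv.Perm (Fin n)))
    (hTPP : TripleProductProperty S T U)
    (hS : ∀ s ∈ S, ∀ s' ∈ S, Equiv.Perm.sign s = Equiv.Perm.sign s')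
    (hT : ∀ t ∈ T, ∀ t' ∈ T, Equiv.Perm.sign t = Equiv.Perm.sign t')
    (hU : ∀ u ∈ U, ∀ u' ∈ U, Equiv.Perm.sign u = Equiv.Perm.sign u')
    (hSne : S.Nonempty) (hTne : T.Nonempty) (hUne : U.Nonempty) (i₀ j₀ : Fin n)
    (hUcyl : ∀ u ∈ U, u j₀ = i₀) :
    (n : ℝ) * (U.card : ℝ) ^ 2 *
        (∑ p : Fin n, ∑ w : Fin n, (((S ×ˢ T).filter fun st => st.2 w = st.1 p).card : ℝ) *
          ((S.filter fun s => s p = i₀).card : ℝ) * ((T.filter fun t => t w = i₀).card : ℝ)) ≤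
      ((n : ℝ) - 1) * ((S.card : ℝ) * T.card * U.card) ^ 2 *
          (∑ v : Fin n, ∑ q ∈ Finset.univ.erase j₀,
            (((U.filter fun u => u q = v).card : ℝ) / U.card -
              (if v = i₀ then (0 : ℝ) else 1 / ((n : ℝ) - 1))) ^ 2) +
        (n.factorial : ℝ) * ((S.card : ℝ) * T.card * U.card) / 2 +
        ((S.card : ℝ) * T.card * U.card) * ((n.factorial : ℝ) * Real.sqrt (n.factorial : ℝ)) /
          (2 * Real.sqrt (((n * (n - 1) : ℕ) : ℝ) / 6)) := by
  have hpin := levelOnePinning n hn S T U hTPP hS hT hU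
  have hcyl := cylinder_sixFold_lower (by omega : 2 ≤ n) S T U i₀ j₀ hSne hTne hUne hUcyl
  set T₃ : ℝ := ((∑ y ∈ ((S ×ˢ T) ×ˢ (T ×ˢ U)) ×ˢ (U ×ˢ S),
      (Finset.univ.filter fun p : Fin n =>
        (y.1.1.1⁻¹ * y.1.1.2 * (y.1.2.1⁻¹ * y.1.2.2) * (y.2.1⁻¹ * y.2.2)) p = p).card : ℕ) : ℝ) with hT₃
  set P : ℝ := ∑ p : Fin n, ∑ w : Fin n, (((S ×ˢ T).filter fun st => st.2 w = st.1 p).card : ℝ) *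
      ((S.filter fun s => s p = i₀).card : ℝ) * ((T.filter fun t => t w = i₀).card : ℝ) with hP
  set η : ℝ := ∑ v : Fin n, ∑ q ∈ Finset.univ.erase j₀,
      (((U.filter fun u => u q = v).card : ℝ) / U.card -
        (if v = i₀ then (0 : ℝ) else 1 / ((n : ℝ) - 1))) ^ 2 with hη
  set N : ℝ := (S.card : ℝ) * T.card * U.card with hN
  set uR : ℝ := (U.card : ℝ) with huR
  set D : ℝ := Real.sqrt (((n * (n - 1) : ℕ) : ℝ) / 6) with hD
  have hn1 : (1 : ℝ) < n := by exact_mod_cast (by omega : 1 < n)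
  have hm0 : (0 : ℝ) < (n : ℝ) - 1 := by linarith
  have hD0 : 0 < D := by
    rw [hD]; apply Real.sqrt_pos.2; apply div_pos _ (by norm_num)
    have : 0 < n * (n - 1) := Nat.mul_pos (by omega) (by omega)
    exact_mod_cast this
  -- normalise the pinning inequality
  have eN2 : (((S.card * T.card * U.card) ^ 2 : ℕ) : ℝ) = N ^ 2 := by rw [hN]; push_cast; ring
  have eN1 : ((S.card * T.card * U.card : ℕ) : ℝ) = N := by rw [hN]; push_cast; ring
  rw [eN2, eN1] at hpin
  -- `2(n-1)·(CYL)`: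
  have hcyl2 := mul_le_mul_of_nonneg_left hcyl (by linarith : (0 : ℝ) ≤ 2 * ((n : ℝ) - 1))
  have e1 : 2 * ((n : ℝ) - 1) * (N ^ 2 * (((n : ℝ) - 2) / ((n : ℝ) - 1)) +
      (n : ℝ) / ((n : ℝ) - 1) * uR ^ 2 * P - N ^ 2 * η) =
      2 * ((n : ℝ) - 2) * N ^ 2 + 2 * n * uR ^ 2 * P - 2 * ((n : ℝ) - 1) * N ^ 2 * η := by
    field_simp
  rw [e1] at hcyl2
  -- combine
  have e2 : N * ((n.factorial : ℝ) * Real.sqrt (n.factorial : ℝ)) / (2 * D) =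
      (N * ((n.factorial : ℝ) * Real.sqrt (n.factorial : ℝ)) / D) / 2 := by
    field_simp
  rw [e2]
  linarith

end Summit.MatrixMultiplication.MatrixMultiplication.Theorems.PolynomialSlack
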